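import Literature.MathematicalPhysics.QuantumFieldTheory.Balaban1983to89.B4Ineq116Torus

/-!
# Proposition 2.3 of [1] ON THE TORUS — (1.16) for EVERY `Λ ⊂ T^{(j)}` and (1.17)–(1.18): the restricted
# covariances `C^{(j)}_Λ = ((aL^{−2}Q^*Q + Δ^{(j)})|_Λ)^{−1}` of the concrete scalar torus tower and the decay of
# `δC^{(j)}_Λ = C^{(j)}_Λ − C^{(j)}` in `|x − x′| + dist(x, Λᶜ) + dist(x′, Λᶜ)`, uniformly in Λ, the volume and the
# level; the leaf conjunct `B4.Prop23Printed` (and B1's literal `B1.Prop23Literal`) DISCHARGED for the torus family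

B4 = [4] = T. Bałaban, *Regularity and decay of lattice Green's functions*, Commun. Math. Phys. **89** (1983)
571–597 [cite: Balaban1983RegularityDecay]; B1 = [1] = *(Higgs)₂,₃ quantum fields in a finite volume I*, Commun.
Math. Phys. **85** (1982) 603–636 [cite: Balaban1982Higgs1]; B5 = *Propagators and renormalization transformations
for lattice gauge theories. I*, Commun. Math. Phys. **95** (1984) 17–40 [cite: Balaban1984PropagatorsI].
Cell records: node G-pv07-5j (b2b-balaban-pv07-g8) = the "Λ ⊊ torus, (5.8)" half of `B4Ineq116Torus` NOT-CERTIFIED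
(a) (the torus twin of `B4BoxCov237` §9 and of `B4Prop23ZeroBox`); certification C-pv07-31, DIVERGENCE D-pv07.23.  value = kernel
certificate for a by-reference step, NOT summit progress.  Renders `1983-cmp89-regularity-decay-p003/p004/p024-x2.png`
and `1982-cmp85-higgs23-I-p008/p009/p010-x2.png` read as images by this seat.

## The printed step

* B4 p. 573 [PDF 3]: *"Let us recall that for operators X defined on the unit lattice functions we define the
  operator X|_Λ restricted to a subset Λ by X|_Λ = ΛXΛ, where Λ also denotes the characteristic function of the set
  Λ. We have C^{(k)}_Λ(Ω, A) = ((Δ^{(k)}(Ω, A) + aL^{−2}P(A))|_Λ)^{−1}. (1.13) Here Δ^{(k)}(Ω, A) is an operator of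
  the effective Gaussian action after k renormalization transformations and can be defined by Δ^{(k)}(Ω, A) = a_kI
  − a_k²Q_k(A)G_k(Ω, A)Q_k^*(A), (1.14)"*.
* B4 p. 574 [PDF 4]: *"Proposition 2.3 of [1]. There exist positive constants δ₀, c₀, γ₀, γ₁ dependent on d and M
  only and such that for arbitrary Λ ⊂ Ω^{(k)} = Ω∩Z^d, Λ being a sum of big blocks and for e sufficiently small, we
  have γ₀I ≤ Δ^{(k)}(Ω, A) + aL^{−2}P(A) ≤ γ₁I, (1.15) |C^{(k)}_Λ(Ω, A; x, x′)| ≤ c₀ exp(−δ₀|x − x′|), x, x′ ∈ Λ.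
  (1.16) In particular the above inequality holds for C^{(k)}(Ω, A). Putting δC^{(k)}_Λ(Ω, A) = C^{(k)}_Λ(Ω, A) −
  C^{(k)}(Ω, A), (1.17) we have also |δC^{(k)}_Λ(Ω, A; x, x′)| ≤ c₀ exp(−δ₀(|x − x′| + dist(x, Λ^c) + dist(x′,
  Λ^c))), x, x′ ∈ Λ. (1.18) Finally, for Ω ⊂ Ω₀ and δC^{(k)}_Λ(Ω, Ω₀, A) = C^{(k)}_Λ(Ω, A) − C^{(k)}_Λ(Ω₀, A), (1.19)
  we have |δC^{(k)}_Λ(Ω, Ω₀, A; x, x′)| ≤ c₀ exp(−δ₀(|x − x′| + dist(x, Ω^{(k)c}) + dist(x′, Ω^{(k)c}))), x, x′ ∈ Λ.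
  (1.20)"*.
* B4 p. 594 [PDF 24]: *"From these properties it follows that Proposition I.2.3 is a consequence of the following
  Theorem. Let Ω ⊂ Z^d and let A be a symmetric operator defined on the space L²(Ω) of functions φ: Ω → R^N and
  satisfying the following condition: there exist positive constants γ₀, c₀, δ₀ such that A ≥ γ₀I, |A(x, x′)| ≤
  c₀e^{−δ₀|x−x′|}, x, x′ ∈ Ω. (5.6) Then there exist positive constants c₁, δ₁ such that for arbitrary Λ ⊂ Ω and for
  C_Λ = A_Λ^{−1}, A_Λ is an operator defined on L²(Λ) by A_Λ = ΛAΛ. We have |C_Λ(x, x′)| ≤ c₁e^{−δ₁|x−x′|}, x, x′ ∈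
  Λ, (5.7) |δC_Λ(x, x′)| ≤ c₁e^{−δ₁(|x−x′| + dist(x, Λ^c) + dist(x′, Λ^c))}, δC_Λ = C_Λ − C_Ω. (5.8)"* — kernel-proved
  over an arbitrary finite index set with a pseudo-distance and a uniform profile bound by the b04 lineage:
  `B4Sect5Torus.inv_submatrix_decay` ((5.7) for every compression, finite Combes–Thomas) and
  `B4Sect5Torus.deltaC_eq` / `deltaC_bound` ((5.8), through the block-resolvent identity `A_Λ^{−1} − A^{−1}|_Λ =
  A_Λ^{−1}·(ΛAΛᶜ)·A^{−1}|_{Λᶜ×Λ}`, not the printed random walk (5.24)–(5.27)).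
* B1 p. 611 [PDF 9]: *"For an operator A defined on configurations φ: Ω^{(k)} → R^N we define A↾_Λ as an operator on
  configurations φ: Λ → R^N by the formula A↾_Λφ = ΛAΛφ. We will use the following covariances also C^{(k)}_Λ(Ω, A) =
  ((aL^{−2}P(A) + Δ^{(k)}(Ω, A))↾_Λ)^{−1}. (2.32) Here we will assume that the set Λ is a union of big blocks of
  T₁^{(k)}. Proposition 2.3. If a configuration A is regular on Ω in the sense defined in Proposition 2.1, then there
  exist positive constants δ₀, c₀, γ₀, γ₁, dependent on d and a, and independent of A, k, Ω and Λ, such that γ₀I ≤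
  aL^{−2}P(A) + Δ^{(k)}(Ω, A) ≤ γ₁I, (2.33) |C^{(k)}_Λ(Ω, A; x, x′)| ≤ c₀ exp(−δ₀|x − x′|), x, x′ ∈ Λ. (2.34) In
  particular the above inequality holds for C^{(k)}(Ω, A). Putting δC^{(k)}_Λ(Ω, A) = C^{(k)}_Λ(Ω, A) − C^{(k)}(Ω, A),
  (2.35)"*, p. 612 [PDF 10]: *"we have |δC^{(k)}_Λ(Ω, A; x, x′)| ≤ c₀ exp(−δ₀(|x − x′| + dist(x, Λ^c) + dist(x′,
  Λ^c))), x, x′ ∈ Λ. (2.36) Finally, for Ω ⊂ Ω₀ and δC^{(k)}_Λ(Ω, Ω₀, A) = C^{(k)}_Λ(Ω, A) − C^{(k)}_Λ(Ω₀, A), (2.37)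
  we have similarly |δC^{(k)}_Λ(Ω, Ω₀, A; x, x′)| ≤ c₀ exp(−δ₀(|x − x′| + dist(x, Ω^{(k)c}) + dist(x′, Ω^{(k)c}))), x,
  x′ ∈ Λ. (2.38)"* (typed VERBATIM by the pv07 lineage as `B1.Prop23Literal` / `B1.Ineq233_238` over b04's carrier
  `B4.UnitSetting`, with `B1.prop23Printed_of_literal : Prop23Literal fam → B4.Prop23Printed fam`); same page, above:
  *"Let us notice that Ω^c means a complement in T_η, so in the case Ω = T_η the condition dist({x, x′}, Ω^c) ≥ R₀ is
  meaningless and is omitted."*; pp. 609–610 [PDF 7–8]: *"… paper we will use the case Ω = T_ε only, but in the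
  second part the necessity of the considerations of more general Ω will arise."*

## What this file proves (U = 1, Ω = Ω₀ = the whole torus T^{(j)}, Λ ⊂ T^{(j)} ARBITRARY, m² ≥ 0 under a mass
## cap, a > 0, levels j ≥ 1)

Objects, all from the cone: the tower's argument `B4Ineq115Torus.Carg P a msq j = aL^{−2}Q^*Q + Δ^{(j)}` of
(2.31)/(1.13) (`P : Params` = (d, L, m, K); `Site P j = (ℤ/N_j)^d` the level-j unit torus), `B5Display136Torus.Crs
= Carg^{−1}` = C^{(j)} (`B4Ineq115Torus.Crs_eq`), the sup torus metric `B5Ineq137Torus.T P j` (= the printed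
|x − x′| in L^jε-units), b04's §5 engine `B4Sect5Torus` (pseudo-distance `T_isPseudoDist`, profile `T_sumBound` of
`B5Leaf237C0Torus`) and the (5.6) verification `B4Ineq116Torus.Carg_hyp56` (`γ₀ = gamma115u L a`, `c₀ = c116`,
`δ₀ = κ/(d′+1)` with b04's window constants `(κ, M)`, `DecayHyp` / `decayHyp_exists`).
* §1 THE OBJECTS OF (1.13)/(2.32) AND (1.17)/(2.35): for a map `e : m → Site P j` (an injection in every use; its
  range is Λ and `X|_Λ = ΛXΛ = Matrix.submatrix X e e`), `CLam P a msq j e = ((Carg)|_Λ)^{−1}` and `deltaC P a msq j e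
  = CLam − Crs|_Λ` (`deltaC_apply`); *"In particular the above inequality holds for C^{(k)}(Ω, A)"*: `CLam_id` (Λ =
  T^{(j)} gives `Crs`), `CLam_equiv` / `deltaC_equiv` (any relabelling of the whole torus: δC = 0); the printed
  `dist(y, Λᶜ)` = `distC P j Λ y = inf_{z ∉ Λ} T^{(j)}(y, z)` for a `Finset Λ` (complement INSIDE the torus, inf ∅ = 0;
  `distC_nonneg`, `distC_le`, `distC_le_of_not_range`).
* §2 AT ONE VOLUME (`P = mkP d′ L m K`, the indexing of `B4Ineq116Torus`): the constants `d118 = δ₁ =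
  B4Sect5Torus.rate K_{d′+1} γ₀ c116 (κ/(d′+1))` (THE SAME rate as `B4Ineq116Torus.abs_Crs_le`) and `c118 =
  B4Sect5Torus.bigC (same arguments)` (`c116_pos`, `d118_pos`, `c118_nonneg`); **(1.16) FOR EVERY Λ** `abs_CLam_le`:
  `|C^{(j)}_Λ(e i, e i′)| ≤ (2/γ₀)e^{−δ₁T^{(j)}(e i, e i′)}` by `inv_submatrix_decay`; **(1.18)** `abs_deltaC_le`:
  `|δC^{(j)}_Λ(e i, e i′)| ≤ c118·e^{−(δ₁/4)(T^{(j)}(e i, e i′) + β i + β i′)}` for every weight `0 ≤ β i ≤ T^{(j)}(e i,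
  z)` (`z` off the range) by `deltaC_bound`; its `Finset` form with the printed weight `β = dist(·, Λᶜ)`
  (`abs_deltaC_le_distC`).
* §3 UNIFORMLY — for every `d ≥ 1`, odd `L > 1`, `a > 0`, `m²₊` there are `δ₀ > 0`, `c₀ ≥ 0`, FUNCTIONS OF `d, L, a,
  m²₊` ONLY, such that for EVERY `P : Params` with `P.d = d`, `P.L = L` (every volume (m, K)), every `m² ≥ 0`, every
  level `1 ≤ j ≤ m + K` with `(L^jε)²m² ≤ m²₊` and EVERY Λ: **`cov116_sub_torus`** ((1.16) for `C^{(j)}_Λ`),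
  **`cov118_torus`** ((1.18), general weight), **`cov118_torus_finset`** ((1.18) with `dist(·, Λᶜ)`).
* §4 THE LEAF CONJUNCT.  The torus instance family `torusFam d L a m²₊ : TorusInst d L m²₊ → B4.UnitSetting` — one
  instance = (P with `P.d = d`, `P.L = L`; `m² ≥ 0`; a level `1 ≤ j ≤ m + K` under the cap; `Λ : Finset (Site P j)`),
  read with Ω = Ω₀ = T^{(j)}, A = 0: `LSite = Λ`, `udist = T^{(j)}`, `distLc = dist(·, Λᶜ)`, `kerC = |C^{(j)}_Λ|`,
  `kerDC = |δC^{(j)}_Λ|` ((1.17)), `kerDC0 = |C^{(j)}_Λ(T^{(j)}) − C^{(j)}_Λ(T^{(j)})|` ((1.19) at Ω = Ω₀), `distOc =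
  dist(·, T^{(j)c}) = distC univ` (empty complement), `form115 γ₀ γ₁` = the two inequalities (1.15) for `Carg` on all
  of `ℝ^{T^{(j)}}`, `e = ι.e` (the charge, a COORDINATE of the index, v1.1), `regular = bigBlocks = True` — satisfies
  **`prop23Literal_torusFam : B1.Prop23Literal
  (torusFam d L a m²₊)`** (B1's Prop. 2.3 (2.33)–(2.38) as printed, no smallness clause) and hence
  **`prop23Printed_torusFam : B4.Prop23Printed (torusFam d L a m²₊)`** — b04's verbatim typing of "Proposition 2.3 of
  [1]" (1.15)–(1.20), conjunct 2 of the DAG leaf `B4.LeafB4` — with `γ₀ = gamma115u L a`, `γ₁ = aL^{−2} + a`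
  (`B4Ineq115Torus.ineq115`), `δ₀ = δ₁/4`, `c₀ = max(2/γ₀, c118)`, threshold `e₁ = 1`; and, because the charge is
  a coordinate of the index on which no carrier field depends, **`prop23Printed_torusFam_iff_literal : B4.Prop23Printed
  (torusFam d L a m²₊) ↔ B1.Prop23Literal (torusFam d L a m²₊)`** for EVERY `d, L, a, m²₊` (v1.1) — the typed
  corollary carries exactly the content of the literal one (NON-VACUITY as a kernel statement, see HONEST SCOPE (ii)).

## Dictionary / HONEST SCOPE

(i) Ω = Ω₀ = the whole torus only (B1 p. 610: *"the case Ω = T_ε only"* is the case of part I): (1.19)–(1.20) carry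
NO content for this family (`kerDC0 = |X − X| = 0`; `distOc = distC univ = 0`, the complement of Ω^{(k)} in the torus
being empty — B1 p. 611 *"meaningless and is omitted"*), and `dist(x, Λᶜ)` is the torus distance to `T^{(j)} ∖ Λ`
(`0` by the `inf ∅` convention when Λ = T^{(j)}, where δC = 0 anyway, `deltaC_equiv`).  (ii) U = 1 / A = 0: "A
regular" is vacuous (`regular = True`) and NO carrier field depends on the charge; "for e sufficiently small" is b04's
typed threshold `∃ e₁ > 0, ∀ i, … 0 < (fam i).e → (fam i).e ≤ e₁ → …` of `B4.Prop23Printed`, which is met NON-VACUOUSLY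
only by a family whose charges accumulate at 0 — so (v1.1) the charge `e` is a COORDINATE of the index `TorusInst` (the
pattern of `B4Prop23ZeroBox.ZeroBoxIdx.e`, pv17 lineage): every configuration `(P, m², j, Λ)` occurs with every charge,
and `prop23Printed_torusFam_iff_literal` records that the typed statement says exactly what the threshold-free literal
`B1.Prop23Literal` says.  (v1 had the CONSTANT `e := 1`, under which `B4.Prop23Printed (torusFam …)` — though derived
there from the genuine `prop23Literal_torusFam` — was ALSO inhabited by the junk threshold `e₁ := 1/2` for every `d, L,
a, m²₊`, i.e. content-free as typed: self-audit C-pv07-43, kernel witness `xread_pv07_vacuity_prop23_torus` in the cell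
file `HOME/b2b-balaban-pv07/SELFAUDIT-B4Ineq118Torus-v1.vacuity.lean`; the same typing hazard as C-pv10-70 O1/P1.)
(iii) NO big-block condition on Λ
(`bigBlocks = True`): the §5 route gives (1.16)/(1.18) for arbitrary Λ ⊂ Ω, exactly as the Sect. 5 Theorem is printed
(*"for arbitrary Λ ⊂ Ω"*); B1's *"Λ is a union of big blocks"* is needed by the §3 route of [4] only.  (iv) Printed
route vs the tree's: [4] proves (5.8) by the random-walk expansion (5.24)–(5.27); `B4Sect5Torus.deltaC_bound` uses the
block-resolvent identity and (5.7) — same statement, different proof (D-pv07.23, as D-b04 for the engine).  (v)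
Distance = sup torus metric `T^{(j)}` in L^jε-units ([4]'s |x − x′| is not specified among ℓ¹/ℓ²/ℓ^∞; constants are
dimension-dependent anyway).  (vi) Dimension indexing as `B4Ineq116Torus` HONEST SCOPE (ii): one-volume statements for
`mkP d′ L m K = ⟨d′+1, L, m, K⟩`, uniform statements and the family over ALL `P` with `P.d = d ≥ 1` (by `cases P`).
(vii) The mass cap `(L^jε)²m² ≤ m²₊` as `B4Ineq116Torus` (iii).  (viii) Constants are explicit functions of b04's
`(κ, M)`, which are existential (contour shift): no numerical values; "dependent on d and M only" / "on d and a"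
becomes "on d, L, a, m²₊" (cf. D-b04.4, census C-B5-5: L is silently a constant for Bałaban).

## NOT-CERTIFIED

(a) Ω ⊊ torus (regions with Neumann conditions, parallelepipeds □ ⊂ ℤ^d), hence the non-empty content of
(1.19)–(1.20) and of (5.5)/(5.9)–(5.10): not here (`B4BoxCov237` §8–§9 and `B4TwoBox120`, pv17 lineage, treat boxes
in ℤ^d).  (b) U ≠ 1 / a background field A.  (c) j = 0 (`B5Leaf237C0Torus`; a₀ is not Bałaban's).  (d) γ₁ *"=
a(a_k/a_{k+1})"* of (5.1) p. 593: ours is the cruder `aL^{−2} + a` of `B4Ineq115Torus.ineq115_upper`.  (e) The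
operator-norm consequences `γ₁^{−1} ≤ C^{(j)}_Λ ≤ γ₀^{−1}` for Λ ⊊ T^{(j)} are not spelled out (for Λ = T^{(j)}:
`B4Ineq115Torus.Crs_form_bounds`).

## DISTINCTNESS (other formalizations in the tree)

`B4Prop23ZeroBox` (pv17-g7, p182682): `B4.Prop23Printed` PROVED for the zero-field NESTED-NEUMANN-BOX family in ℤ^d
(`prop23Printed_zeroFieldBoxes`: the abstract box operator `B4BoxCov237.covOp` over a WINDOW of constants `a_j ∈
[a₋, a₊]`, `m_j² ∈ [0, m²₊]`, `a ∈ [a₂₋, a₂₊]`, inner box □ ⊂ outer box □₀, so (1.19)–(1.20) carry content there) —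
the pattern followed by §4 here; `B4BoxCov237` §8–§9 (pv17): (1.16)/(1.17)–(1.18) for sub-regions Λ of a BOX □ ⊂ ℤ^d
with the box Green machinery (`cov118_box_sub_delta`, `cov118_box_finset_delta`, its own `distC` on `boxDom`);
`B6DomainChange` (b06): the abstract shape of (5.8)/(5.10) for B6's change of domain; `Beta/FluctuationCovariance`
(pv23): (1.15)/(1.16) for the toy operator `Cop` on `Beta.EffectiveKernel.Tor`; `B4Ineq116Torus` (this lineage): the
case Λ = T^{(j)} (`abs_Crs_le`, `cov116_torus` — recovered here through `CLam_id` with the same constants).  The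
present file is the TORUS member (Ω = Ω₀ = T^{(j)}, B1's *"case Ω = T_ε only"*) and the only one about the B1RG242Torus
tower's own `C^{(j)}_Λ` for Λ ⊊ T^{(j)} — the operators `Carg`/`Crs` read by `B5Display136Torus.K2_eq` and the located
leaf `B5Ineq137.Leaf235to237`, with the window of constants DERIVED from the tower (`a_j ∈ [a(1 − L^{−2}), a]` by
`B1.ainf_lt_aSeq`/`B1.aSeq_le`, `m_j² = (L^jε)²m²`) rather than assumed — and the first discharge of B1's literal
`B1.Prop23Literal`; it imports none of the files named except `B4Ineq116Torus`; it adds no analytic ingredient — it is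
the instantiation of b04's §5 engine at `B4Ineq116Torus.Carg_hyp56` plus bookkeeping.

Versions: v1.1 (this file) — RETYPE after self-audit C-pv07-43: the index `TorusInst` gains the charge coordinate
`e : ℝ` and `torusFam … e := ι.e` (v1: the constant `1`); NEW `prop23Printed_torusFam_iff_literal` (typed ⟺ literal)
and a threshold example; `prop23Literal_torusFam`'s intro pattern gains one binder; the `TorusInst 4 3 1` example gains
the charge `1`; header §4 bullet and HONEST SCOPE (ii) re-worded; every other declaration byte-identical to v1 (p182718,
commit 454cf75b24dc; certification C-pv07-31, XREAD C-adv9-67).  NOT append-only (one structure field): the by-name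
consumers `DagDischarged.leafB4_conj2_torusFam` / `leafB4_torusFam_iff` and `DagDischargedII` construct no `TorusInst`
and keep their statements verbatim.
-/

namespace Literature.MathematicalPhysics.QuantumFieldTheory.Balaban1983to89

namespace B4Ineq118Torus

open Matrix B1RG242Torus B5Display136Torus B5Leaf237C0Torus B4Ineq115Torus B5Ineq137Torus B4Ineq116Torus

noncomputable section

/-! ## §1 The restricted covariance (1.13)/(2.32), the difference (1.17)/(2.35), the distance to Λᶜ -/

section Objects

variable (P : Params) (a msq : ℝ) (j : ℕ)

/-- **`C^{(j)}_Λ = ((aL^{−2}Q^*Q + Δ^{(j)})|_Λ)^{−1}`** for the concrete torus tower: the inverse of the compression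
`ΛXΛ = X.submatrix e e` of the argument `Carg = aL^{−2}Q^*Q + Δ^{(j)}` along a map `e : m → T^{(j)}` (an injection
whose range is Λ in every use). [cite: Balaban1983RegularityDecay, (1.13) p.573; dictionary]
[cite: Balaban1982Higgs1, (2.32) p.611; dictionary] -/
def CLam {m : Type*} [Fintype m] [DecidableEq m] (e : m → Site P j) : Matrix m m ℝ :=
  ((Carg P a msq j).submatrix e e)⁻¹

/-- **`δC^{(j)}_Λ = C^{(j)}_Λ − C^{(j)}`** (both read on Λ × Λ: the second term is `Crs|_Λ = Crs.submatrix e e`).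
[cite: Balaban1983RegularityDecay, (1.17) p.574; dictionary] [cite: Balaban1982Higgs1, (2.35) p.611; dictionary] -/
def deltaC {m : Type*} [Fintype m] [DecidableEq m] (e : m → Site P j) : Matrix m m ℝ :=
  CLam P a msq j e - (Crs P a msq j).submatrix e e

/-- The entries of `δC^{(j)}_Λ`: `C^{(j)}_Λ(i, i′) − C^{(j)}(e i, e i′)` with `C^{(j)} = Carg^{−1}`. [folklore] -/
theorem deltaC_apply {m : Type*} [Fintype m] [DecidableEq m] (e : m → Site P j) (i i' : m) :
    deltaC P a msq j e i i' = ((Carg P a msq j).submatrix e e)⁻¹ i i' - (Carg P a msq j)⁻¹ (e i) (e i') := rfl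

/-- *"In particular the above inequality holds for C^{(k)}(Ω, A)"*: for Λ = T^{(j)} (`e = id`) the restricted
covariance IS `C^{(j)} = Crs`. [cite: Balaban1983RegularityDecay, p.574 after (1.16); dictionary] -/
theorem CLam_id : CLam P a msq j (id : Site P j → Site P j) = Crs P a msq j := by
  rw [CLam, Crs_eq, Matrix.submatrix_id_id]

/-- The same along any relabelling `σ : m ≃ T^{(j)}` of the whole torus: `C^{(j)}_Λ = C^{(j)}|_Λ`. [folklore] -/
theorem CLam_equiv {m : Type*} [Fintype m] [DecidableEq m] (σ : m ≃ Site P j) :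
    CLam P a msq j σ = (Crs P a msq j).submatrix σ σ := by
  rw [CLam, Crs_eq, Matrix.inv_submatrix_equiv]

/-- Hence `δC^{(j)}_Λ = 0` when Λ is the whole torus. [folklore] -/
theorem deltaC_equiv {m : Type*} [Fintype m] [DecidableEq m] (σ : m ≃ Site P j) :
    deltaC P a msq j σ = 0 := by
  rw [deltaC, CLam_equiv, sub_self]

/-- **`dist(y, Λᶜ)`** for `Λ ⊂ T^{(j)}`: the infimum over `z ∈ T^{(j)} ∖ Λ` of the sup torus distance `T^{(j)}(y, z)`
(complement inside the torus; `inf ∅ = 0` when Λ = T^{(j)}). [cite: Balaban1983RegularityDecay, p.574 (1.18)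
(«dist(x, Λ^c)»); dictionary] -/
def distC (Λ : Finset (Site P j)) (y : Site P j) : ℝ :=
  sInf ((fun z => T P j y z) '' {z | z ∉ Λ})

/-- `dist(y, Λᶜ) ≥ 0`. [folklore] -/
theorem distC_nonneg (Λ : Finset (Site P j)) (y : Site P j) : 0 ≤ distC P j Λ y := by
  unfold distC
  apply Real.sInf_nonneg
  rintro _ ⟨z, -, rfl⟩
  exact T_nonneg P j y z

/-- `dist(y, Λᶜ) ≤ T^{(j)}(y, z)` for every `z ∉ Λ`. [folklore] -/
theorem distC_le (Λ : Finset (Site P j)) (y : Site P j) {z : Site P j} (hz : z ∉ Λ) :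
    distC P j Λ y ≤ T P j y z := by
  unfold distC
  exact csInf_le ⟨0, by rintro _ ⟨w, -, rfl⟩; exact T_nonneg P j y w⟩ ⟨z, hz, rfl⟩

/-- `dist(·, Λᶜ)` is an admissible weight for `B4Sect5Torus.deltaC_bound` along the inclusion `Λ ↪ T^{(j)}`: it is
dominated by the distance to every point off the range. [folklore] -/
theorem distC_le_of_not_range (Λ : Finset (Site P j)) (y : ↥Λ) (z : Site P j)
    (hz : ¬ ∃ y' : ↥Λ, (Subtype.val : ↥Λ → Site P j) y' = z) : distC P j Λ y.1 ≤ T P j y.1 z :=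
  distC_le P j Λ y.1 (fun hzΛ => hz ⟨⟨z, hzΛ⟩, rfl⟩)

/-- `dist(y, T^{(j)c}) = 0` under the same convention: the complement of the whole torus inside the torus is empty
(B1 p. 611: *"Ω^c means a complement in T_η, so in the case Ω = T_η the condition … is meaningless"*). [folklore] -/
theorem distC_univ (y : Site P j) : distC P j Finset.univ y = 0 := by
  unfold distC
  have h : ((fun z => T P j y z) '' {z : Site P j | z ∉ (Finset.univ : Finset (Site P j))}) = ∅ := by
    rw [Set.image_eq_empty]
    ext z
    simp
  rw [h, Real.sInf_empty]

end Objects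

/-! ## §2 (1.16) for every Λ and (1.18), at one volume and level -/

section OneVolume

variable (d' Lb mb Kb : ℕ) (hL : Odd Lb ∧ 1 < Lb) [NeZero Lb]

local notation "Pm" => mkP d' Lb mb Kb hL

/-- **δ₁ of (5.7)/(5.8) for the tower's `Carg`**: `B4Sect5Torus.rate K_{d′+1} γ₀ c₀ κ′` at `γ₀ = gamma115u L a`,
`c₀ = c116`, `κ′ = κ/(d′+1)` — the rate of `B4Ineq116Torus.abs_Crs_le`; a function of `d′, L, a` and b04's `(κ, M)`.
[cite: Balaban1983RegularityDecay, (5.7) p.594; dictionary] -/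
def d118 (a κ M : ℝ) : ℝ :=
  B4Sect5Torus.rate (B4Sect5Proof.latticeConst (d' + 1)) (gamma115u (Lb : ℝ) a) (c116 d' Lb a κ M) (κ / (d' + 1))

/-- **c₁ of (5.8) for the tower's `Carg`**: `B4Sect5Torus.bigC` at the same arguments.
[cite: Balaban1983RegularityDecay, (5.8) p.594; dictionary] -/
def c118 (a κ M : ℝ) : ℝ :=
  B4Sect5Torus.bigC (B4Sect5Proof.latticeConst (d' + 1)) (gamma115u (Lb : ℝ) a) (c116 d' Lb a κ M) (κ / (d' + 1))

omit [NeZero Lb] in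
/-- `0 < c116` (it is `≥ a > 0`): the strict positivity of the (5.6) constant that `B4Sect5Torus.deltaC_bound` asks
for. [folklore] -/
theorem c116_pos {a κ M : ℝ} (ha : 0 < a) (hκ : 0 < κ) (hM : 0 ≤ M) : 0 < c116 d' Lb a κ M := by
  have := periodConst_nonneg hκ.le d'
  unfold c116
  positivity

omit [NeZero Lb] in
/-- `0 < δ₁`. [folklore] -/
theorem d118_pos {a κ M : ℝ} (ha : 0 < a) (hL1 : (1 : ℝ) < Lb) (hκ : 0 < κ) (hM : 0 ≤ M) :
    0 < d118 d' Lb a κ M :=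
  B4Sect5Torus.rate_pos (fun _ hb => B4Sect5Proof.latticeConst_nonneg (d' + 1) hb.le) (gamma115u_pos ha hL1)
    (c116_nonneg d' Lb ha hκ hM) (by positivity)

omit [NeZero Lb] in
/-- `0 ≤ c₁`. [folklore] -/
theorem c118_nonneg {a κ M : ℝ} (ha : 0 < a) (hL1 : (1 : ℝ) < Lb) (hκ : 0 < κ) (hM : 0 ≤ M) :
    0 ≤ c118 d' Lb a κ M :=
  B4Sect5Torus.bigC_nonneg (fun _ hb => B4Sect5Proof.latticeConst_nonneg (d' + 1) hb.le) (gamma115u_pos ha hL1)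
    (c116_nonneg d' Lb ha hκ hM) (by positivity)

/-- **(1.16) FOR EVERY Λ ⊂ T^{(j)}, AT ONE VOLUME AND LEVEL**: for every injection `e : m ↪ T^{(j)}` (range Λ),
`|C^{(j)}_Λ(i, i′)| ≤ (2/γ₀)e^{−δ₁T^{(j)}(e i, e i′)}` with the constants of the case Λ = T^{(j)}
(`B4Ineq116Torus.abs_Crs_le`) — (5.6) for `Carg` (`Carg_hyp56`) passes to every compression
(`B4Sect5Torus.inv_submatrix_decay`). [cite: Balaban1983RegularityDecay, Prop. 2.3 (1.16) p.574 with Sect. 5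
Theorem (5.7) p.594; dictionary] [folklore] -/
theorem abs_CLam_le {a m2plus κ M : ℝ} (ha : 0 < a) (hκ : 0 < κ) (hM : 0 ≤ M) (hdec : DecayHyp d' Lb a m2plus κ M)
    {msq : ℝ} (hmsq : 0 ≤ msq) {j : ℕ} (hj1 : 1 ≤ j) (hj : j ≤ mb + Kb) (hcap : (Pm).spacing j ^ 2 * msq ≤ m2plus)
    {m : Type*} [Fintype m] [DecidableEq m] (e : m → Site Pm j) (he : Function.Injective e) (i i' : m) :
    |CLam Pm a msq j e i i'| ≤
      2 / gamma115u (Lb : ℝ) a * Real.exp (-(d118 d' Lb a κ M * T Pm j (e i) (e i'))) := by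
  have hL1 : (1 : ℝ) < Lb := by exact_mod_cast hL.2
  unfold CLam d118
  exact B4Sect5Torus.inv_submatrix_decay (fun _ hb => B4Sect5Proof.latticeConst_nonneg (d' + 1) hb.le)
    (gamma115u_pos ha hL1) (c116_nonneg d' Lb ha hκ hM) (by positivity) (T_isPseudoDist Pm j) (T_sumBound Pm j)
    (Carg_hyp56 d' Lb mb Kb hL ha hκ hM hdec hmsq hj1 hj hcap) he i i'

/-- **(1.17)–(1.18) ON THE TORUS, AT ONE VOLUME AND LEVEL, EVERY Λ AND EVERY ADMISSIBLE WEIGHT**: for every injection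
`e : m ↪ T^{(j)}` (range Λ) and every `β : m → ℝ` with `0 ≤ β i ≤ T^{(j)}(e i, z)` for all `z` off the range (e.g.
`β = dist(·, Λᶜ)`), `|δC^{(j)}_Λ(i, i′)| = |C^{(j)}_Λ(i, i′) − C^{(j)}(e i, e i′)| ≤ c₁e^{−(δ₁/4)(T^{(j)}(e i, e i′) +
β i + β i′)}` — by `B4Sect5Torus.deltaC_bound` at `Carg_hyp56`. [cite: Balaban1983RegularityDecay, Prop. 2.3
(1.17)–(1.18) p.574 with Sect. 5 Theorem (5.8) p.594; dictionary] [folklore] -/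
theorem abs_deltaC_le {a m2plus κ M : ℝ} (ha : 0 < a) (hκ : 0 < κ) (hM : 0 ≤ M) (hdec : DecayHyp d' Lb a m2plus κ M)
    {msq : ℝ} (hmsq : 0 ≤ msq) {j : ℕ} (hj1 : 1 ≤ j) (hj : j ≤ mb + Kb) (hcap : (Pm).spacing j ^ 2 * msq ≤ m2plus)
    {m : Type*} [Fintype m] [DecidableEq m] (e : m → Site Pm j) (he : Function.Injective e)
    {β : m → ℝ} (hβ0 : ∀ i, 0 ≤ β i) (hβ : ∀ i (z : Site Pm j), (¬ ∃ i', e i' = z) → β i ≤ T Pm j (e i) z)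
    (i i' : m) :
    |deltaC Pm a msq j e i i'| ≤
      c118 d' Lb a κ M * Real.exp (-(d118 d' Lb a κ M / 4 * (T Pm j (e i) (e i') + β i + β i'))) := by
  have hL1 : (1 : ℝ) < Lb := by exact_mod_cast hL.2
  rw [deltaC_apply]
  unfold c118 d118
  exact B4Sect5Torus.deltaC_bound (fun _ hb => B4Sect5Proof.latticeConst_nonneg (d' + 1) hb.le)
    (gamma115u_pos ha hL1) (c116_pos d' Lb ha hκ hM) (by positivity) (T_isPseudoDist Pm j) (T_sumBound Pm j)
    (Carg_hyp56 d' Lb mb Kb hL ha hκ hM hdec hmsq hj1 hj hcap) he hβ0 hβ i i'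

/-- **(1.18) with the printed weight `dist(·, Λᶜ)`** for a `Finset Λ ⊂ T^{(j)}` (inclusion `Λ ↪ T^{(j)}`):
`|δC^{(j)}_Λ(y, y′)| ≤ c₁e^{−(δ₁/4)(T^{(j)}(y, y′) + dist(y, Λᶜ) + dist(y′, Λᶜ))}`, `y, y′ ∈ Λ`.
[cite: Balaban1983RegularityDecay, Prop. 2.3 (1.18) p.574; dictionary] [folklore] -/
theorem abs_deltaC_le_distC {a m2plus κ M : ℝ} (ha : 0 < a) (hκ : 0 < κ) (hM : 0 ≤ M)
    (hdec : DecayHyp d' Lb a m2plus κ M) {msq : ℝ} (hmsq : 0 ≤ msq) {j : ℕ} (hj1 : 1 ≤ j) (hj : j ≤ mb + Kb)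
    (hcap : (Pm).spacing j ^ 2 * msq ≤ m2plus) (Λ : Finset (Site Pm j)) (y y' : ↥Λ) :
    |deltaC Pm a msq j (Subtype.val : ↥Λ → Site Pm j) y y'| ≤
      c118 d' Lb a κ M * Real.exp (-(d118 d' Lb a κ M / 4 *
        (T Pm j y.1 y'.1 + distC Pm j Λ y.1 + distC Pm j Λ y'.1))) :=
  abs_deltaC_le d' Lb mb Kb hL ha hκ hM hdec hmsq hj1 hj hcap (Subtype.val : ↥Λ → Site Pm j)
    Subtype.val_injective (fun y => distC_nonneg Pm j Λ y.1)
    (fun w z hz => distC_le_of_not_range Pm j Λ w z hz) y y'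

end OneVolume

/-! ## §3 Uniformly in the volume, the level and Λ -/

section Uniform

/-- **B4 PROPOSITION 2.3 (1.16) ON THE TORUS FOR EVERY RESTRICTED COVARIANCE `C^{(j)}_Λ` OF THE CONCRETE SCALAR
TOWER.**  For every dimension `d ≥ 1`, odd `L > 1`, `a > 0` and mass cap `m²₊` there are `δ₀ > 0`, `c₀ ≥ 0`
depending on `d, L, a, m²₊` ONLY such that for EVERY volume (`P.d = d`, `P.L = L`, any `m, K`), every `m² ≥ 0`,
every level `1 ≤ j ≤ m + K` with `(L^jε)²m² ≤ m²₊`, EVERY injection `e : m ↪ T^{(j)}` (range Λ) and all `i, i′`: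
`|C^{(j)}_Λ(i, i′)| = |(((aL^{−2}Q^*Q + Δ^{(j)})|_Λ)^{−1})(i, i′)| ≤ c₀e^{−δ₀T^{(j)}(e i, e i′)}` — the constants
being those of `B4Ineq116Torus.cov116_torus` (Λ = T^{(j)}). [cite: Balaban1983RegularityDecay, Prop. 2.3 (1.16)
p.574 («for arbitrary Λ ⊂ Ω^{(k)}») with p.572 (torus); dictionary] [folklore] -/
theorem cov116_sub_torus (d L : ℕ) (hd : 1 ≤ d) (hL : Odd L ∧ 1 < L) {a : ℝ} (ha : 0 < a) (m2plus : ℝ) :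
    ∃ δ₀ c₀ : ℝ, 0 < δ₀ ∧ 0 ≤ c₀ ∧ ∀ (P : Params), P.d = d → P.L = L → ∀ (msq : ℝ), 0 ≤ msq →
      ∀ j : ℕ, 1 ≤ j → j ≤ P.m + P.K → P.spacing j ^ 2 * msq ≤ m2plus →
        ∀ {m : Type*} [Fintype m] [DecidableEq m] (e : m → Site P j), Function.Injective e →
          ∀ i i' : m, |CLam P a msq j e i i'| ≤ c₀ * Real.exp (-(δ₀ * T P j (e i) (e i'))) := by
  obtain ⟨d', rfl⟩ : ∃ d', d = d' + 1 := ⟨d - 1, by omega⟩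
  haveI : NeZero L := ⟨by have := hL.2; omega⟩
  have hL1 : (1 : ℝ) < L := by exact_mod_cast hL.2
  obtain ⟨κ, M, hκ, hM, hdec⟩ := decayHyp_exists d' L ha hL1 m2plus
  refine ⟨d118 d' L a κ M, 2 / gamma115u (L : ℝ) a, d118_pos d' L ha hL1 hκ hM,
    (div_pos two_pos (gamma115u_pos ha hL1)).le, ?_⟩
  intro P hPd hPL msq hmsq j hj1 hj hcap m _ _ e he i i'
  obtain ⟨dP, LP, mP, KP, hdP, hLP⟩ := P
  simp only at hPd hPL
  subst hPd hPL
  exact abs_CLam_le d' LP mP KP hLP ha hκ hM hdec hmsq hj1 hj hcap e he i i'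

/-- **B4 PROPOSITION 2.3 (1.17)–(1.18) ON THE TORUS FOR THE CONCRETE SCALAR TOWER, EVERY Λ, EVERY ADMISSIBLE
WEIGHT.**  For every `d ≥ 1`, odd `L > 1`, `a > 0`, `m²₊` there are `δ₀ > 0`, `c₀ ≥ 0` depending on `d, L, a, m²₊`
ONLY such that for EVERY volume, every `m² ≥ 0`, every level `1 ≤ j ≤ m + K` under the cap, EVERY injection `e : m ↪
T^{(j)}` (range Λ), every weight `0 ≤ β i ≤ T^{(j)}(e i, z)` (`z` off the range) and all `i, i′`:
`|δC^{(j)}_Λ(i, i′)| = |C^{(j)}_Λ(i, i′) − C^{(j)}(e i, e i′)| ≤ c₀e^{−δ₀(T^{(j)}(e i, e i′) + β i + β i′)}`.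
[cite: Balaban1983RegularityDecay, Prop. 2.3 (1.17)–(1.18) p.574 with Sect. 5 Theorem (5.8) p.594 and p.572
(torus); dictionary] [folklore] -/
theorem cov118_torus (d L : ℕ) (hd : 1 ≤ d) (hL : Odd L ∧ 1 < L) {a : ℝ} (ha : 0 < a) (m2plus : ℝ) :
    ∃ δ₀ c₀ : ℝ, 0 < δ₀ ∧ 0 ≤ c₀ ∧ ∀ (P : Params), P.d = d → P.L = L → ∀ (msq : ℝ), 0 ≤ msq →
      ∀ j : ℕ, 1 ≤ j → j ≤ P.m + P.K → P.spacing j ^ 2 * msq ≤ m2plus →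
        ∀ {m : Type*} [Fintype m] [DecidableEq m] (e : m → Site P j), Function.Injective e →
          ∀ β : m → ℝ, (∀ i, 0 ≤ β i) → (∀ i (z : Site P j), (¬ ∃ i', e i' = z) → β i ≤ T P j (e i) z) →
            ∀ i i' : m, |deltaC P a msq j e i i'| ≤
              c₀ * Real.exp (-(δ₀ * (T P j (e i) (e i') + β i + β i'))) := by
  obtain ⟨d', rfl⟩ : ∃ d', d = d' + 1 := ⟨d - 1, by omega⟩
  haveI : NeZero L := ⟨by have := hL.2; omega⟩
  have hL1 : (1 : ℝ) < L := by exact_mod_cast hL.2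
  obtain ⟨κ, M, hκ, hM, hdec⟩ := decayHyp_exists d' L ha hL1 m2plus
  refine ⟨d118 d' L a κ M / 4, c118 d' L a κ M, by have := d118_pos d' L ha hL1 hκ hM; positivity,
    c118_nonneg d' L ha hL1 hκ hM, ?_⟩
  intro P hPd hPL msq hmsq j hj1 hj hcap m _ _ e he β hβ0 hβ i i'
  obtain ⟨dP, LP, mP, KP, hdP, hLP⟩ := P
  simp only at hPd hPL
  subst hPd hPL
  exact abs_deltaC_le d' LP mP KP hLP ha hκ hM hdec hmsq hj1 hj hcap e he hβ0 hβ i i'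

/-- **(1.17)–(1.18) ON THE TORUS WITH THE PRINTED WEIGHT `dist(·, Λᶜ)`**, for every `Finset Λ ⊂ T^{(j)}` and `y, y′
∈ Λ`: `|δC^{(j)}_Λ(y, y′)| ≤ c₀e^{−δ₀(T^{(j)}(y, y′) + dist(y, Λᶜ) + dist(y′, Λᶜ))}`, same uniformity.
[cite: Balaban1983RegularityDecay, Prop. 2.3 (1.17)–(1.18) p.574 with p.572 (torus); dictionary] [folklore] -/
theorem cov118_torus_finset (d L : ℕ) (hd : 1 ≤ d) (hL : Odd L ∧ 1 < L) {a : ℝ} (ha : 0 < a) (m2plus : ℝ) :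
    ∃ δ₀ c₀ : ℝ, 0 < δ₀ ∧ 0 ≤ c₀ ∧ ∀ (P : Params), P.d = d → P.L = L → ∀ (msq : ℝ), 0 ≤ msq →
      ∀ j : ℕ, 1 ≤ j → j ≤ P.m + P.K → P.spacing j ^ 2 * msq ≤ m2plus →
        ∀ (Λ : Finset (Site P j)) (y y' : ↥Λ),
          |deltaC P a msq j (Subtype.val : ↥Λ → Site P j) y y'| ≤
            c₀ * Real.exp (-(δ₀ * (T P j y.1 y'.1 + distC P j Λ y.1 + distC P j Λ y'.1))) := by
  obtain ⟨δ₀, c₀, hδ, hc, h⟩ := cov118_torus d L hd hL ha m2plus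
  refine ⟨δ₀, c₀, hδ, hc, ?_⟩
  intro P hPd hPL msq hmsq j hj1 hj hcap Λ y y'
  exact h P hPd hPL msq hmsq j hj1 hj hcap (Subtype.val : ↥Λ → Site P j) Subtype.val_injective
    (fun y : ↥Λ => distC P j Λ y.1) (fun y => distC_nonneg P j Λ y.1)
    (fun w z hz => distC_le_of_not_range P j Λ w z hz) y y'

end Uniform

/-! ## §4 The leaf conjunct: `B1.Prop23Literal` / `B4.Prop23Printed` for the torus instance family -/

section Leaf

/-- ONE INSTANCE of "Proposition 2.3 of [1]" realised on the torus with U = 1: a volume `P` of dimension `d` and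
block size `L` (any `m, K`), a mass `m² ≥ 0`, a level `1 ≤ j ≤ m + K` under the cap `(L^jε)²m² ≤ m²₊`, a subset
`Λ ⊂ T^{(j)}` (Ω = Ω₀ = T^{(j)}), and (v1.1) the charge `e` as a coordinate (no carrier field depends on it at A = 0;
it is there so that b04's typed threshold «for e sufficiently small» quantifies over instances accumulating at e = 0).
[cite: Balaban1983RegularityDecay, (1.13)–(1.20) pp.573–574; dictionary] -/
structure TorusInst (d L : ℕ) (m2plus : ℝ) where
  /-- the volume / tower parameters (d, L, m, K) -/
  P : Params
  hd : P.d = d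
  hL : P.L = L
  /-- the bare mass squared -/
  msq : ℝ
  hmsq : 0 ≤ msq
  /-- the level -/
  j : ℕ
  hj1 : 1 ≤ j
  hj : j ≤ P.m + P.K
  hcap : P.spacing j ^ 2 * msq ≤ m2plus
  /-- the subset Λ of the level-j unit torus -/
  Λ : Finset (Site P j)
  /-- the charge `e` (a coordinate of the index; v1.1) -/
  e : ℝ

/-- THE TORUS INSTANCE FAMILY as b04's carrier `B4.UnitSetting` (Ω = Ω₀ = T^{(j)}, A = 0): `LSite = Λ`, `udist =
T^{(j)}`, `distLc = dist(·, Λᶜ)`, `distOc = dist(·, T^{(j)c}) = distC univ`, `kerC = |C^{(j)}_Λ|`, `kerDC =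
|δC^{(j)}_Λ|` (1.17), `kerDC0 = |C^{(j)}_Λ(Ω) − C^{(j)}_Λ(Ω₀)|` (1.19) at Ω = Ω₀, `form115 γ₀ γ₁` = `γ₀‖ψ‖² ≤ ⟨ψ,
(aL^{−2}Q^*Q + Δ^{(j)})ψ⟩ ≤ γ₁‖ψ‖²` on `ℝ^{T^{(j)}}`, `e = ι.e` (v1.1; v1: `1`), `regular = bigBlocks = True`.
[cite: Balaban1983RegularityDecay, (1.13)–(1.20) pp.573–574; dictionary] -/
def torusFam (d L : ℕ) (a m2plus : ℝ) (ι : TorusInst d L m2plus) : B4.UnitSetting where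
  LSite := ↥ι.Λ
  e := ι.e
  regular := True
  bigBlocks := True
  udist := fun x x' => T ι.P ι.j x.1 x'.1
  distLc := fun x => distC ι.P ι.j ι.Λ x.1
  distOc := fun x => distC ι.P ι.j Finset.univ x.1
  kerC := fun x x' => |CLam ι.P a ι.msq ι.j (Subtype.val : ↥ι.Λ → Site ι.P ι.j) x x'|
  kerDC := fun x x' => |deltaC ι.P a ι.msq ι.j (Subtype.val : ↥ι.Λ → Site ι.P ι.j) x x'|
  kerDC0 := fun x x' =>
    |CLam ι.P a ι.msq ι.j (Subtype.val : ↥ι.Λ → Site ι.P ι.j) x x' -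
      CLam ι.P a ι.msq ι.j (Subtype.val : ↥ι.Λ → Site ι.P ι.j) x x'|
  form115 := fun γ₀ γ₁ => ∀ ψ : Site ι.P ι.j → ℝ,
    γ₀ * (ψ ⬝ᵥ ψ) ≤ ψ ⬝ᵥ (Carg ι.P a ι.msq ι.j *ᵥ ψ) ∧ ψ ⬝ᵥ (Carg ι.P a ι.msq ι.j *ᵥ ψ) ≤ γ₁ * (ψ ⬝ᵥ ψ)

/-- Weakening the rate of (1.16) from `δ₁` to the common `δ₀ = δ₁/4` and the constant to `max(2/γ₀, c₁)`. [folklore] -/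
theorem weaken116 {γ c δ t : ℝ} (hγ : 0 < γ) (hδ : 0 ≤ δ) (ht : 0 ≤ t) :
    2 / γ * Real.exp (-(δ * t)) ≤ max (2 / γ) c * Real.exp (-(δ / 4 * t)) := by
  have h1 : Real.exp (-(δ * t)) ≤ Real.exp (-(δ / 4 * t)) := Real.exp_le_exp.mpr (by nlinarith)
  exact mul_le_mul (le_max_left _ _) h1 (Real.exp_pos _).le ((div_pos two_pos hγ).le.trans (le_max_left _ _))

/-- **B1 PROPOSITION 2.3 (2.33)–(2.38), AS PRINTED (no smallness clause), HOLDS FOR THE TORUS INSTANCE FAMILY**: for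
every `d ≥ 1`, odd `L > 1`, `a > 0`, `m²₊` there are positive `δ₀, c₀, γ₀, γ₁` — functions of `d, L, a, m²₊` only:
`γ₀ = gamma115u L a`, `γ₁ = aL^{−2} + a`, `δ₀ = δ₁/4`, `c₀ = max(2/γ₀, c₁)` — with (2.33) (= `B4Ineq115Torus.ineq115`),
(2.34) for every Λ (`abs_CLam_le`), (2.36) (`abs_deltaC_le_distC`) and (2.38) (empty at Ω = Ω₀) for EVERY instance.
[cite: Balaban1982Higgs1, Prop. 2.3 (2.33)–(2.38) pp.611–612 with p.610 («the case Ω = T_ε only»); dictionary]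
[folklore] -/
theorem prop23Literal_torusFam (d L : ℕ) (hd : 1 ≤ d) (hL : Odd L ∧ 1 < L) {a : ℝ} (ha : 0 < a) (m2plus : ℝ) :
    B1.Prop23Literal (torusFam d L a m2plus) := by
  obtain ⟨d', rfl⟩ : ∃ d', d = d' + 1 := ⟨d - 1, by omega⟩
  haveI : NeZero L := ⟨by have := hL.2; omega⟩
  have hL1 : (1 : ℝ) < L := by exact_mod_cast hL.2
  obtain ⟨κ, M, hκ, hM, hdec⟩ := decayHyp_exists d' L ha hL1 m2plus
  have hγ : 0 < gamma115u (L : ℝ) a := gamma115u_pos ha hL1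
  have hδ : 0 < d118 d' L a κ M := d118_pos d' L ha hL1 hκ hM
  have hmax : 0 < max (2 / gamma115u (L : ℝ) a) (c118 d' L a κ M) := lt_max_of_lt_left (div_pos two_pos hγ)
  refine ⟨d118 d' L a κ M / 4, max (2 / gamma115u (L : ℝ) a) (c118 d' L a κ M), gamma115u (L : ℝ) a,
    a * ((L : ℝ) ^ 2)⁻¹ + a, by positivity, hmax, hγ, by positivity, ?_⟩
  rintro ⟨P, hPd, hPL, msq, hmsq, j, hj1, hj, hcap, Λ, _e⟩ - -
  obtain ⟨dP, LP, mP, KP, hdP, hLP⟩ := P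
  simp only at hPd hPL
  subst hPd hPL
  refine ⟨fun ψ => ?_, fun x x' => ?_, fun x x' => ?_, fun x x' => ?_⟩
  · -- (2.33) = (1.15)
    exact ineq115 ha hmsq hj1 ψ
  · -- (2.34) = (1.16) for C_Λ, rate δ₁ weakened to δ₁/4
    exact (abs_CLam_le d' LP mP KP hLP ha hκ hM hdec hmsq hj1 hj hcap _ Subtype.val_injective x x').trans
      (weaken116 hγ hδ.le (T_nonneg _ j _ _))
  · -- (2.36) = (1.18)
    exact (abs_deltaC_le_distC d' LP mP KP hLP ha hκ hM hdec hmsq hj1 hj hcap Λ x x').trans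
      (mul_le_mul_of_nonneg_right (le_max_right _ _) (Real.exp_pos _).le)
  · -- (2.38) = (1.20): empty at Ω = Ω₀ = T^{(j)}
    show |_ - _| ≤ _
    rw [sub_self, abs_zero]
    positivity

/-- **"PROPOSITION 2.3 OF [1]" AS RESTATED AND TYPED IN [4] (1.15)–(1.20) — `B4.Prop23Printed`, conjunct 2 of the
leaf `B4.LeafB4` — HOLDS FOR THE TORUS INSTANCE FAMILY** (every dimension `d ≥ 1`, odd `L > 1`, `a > 0`, mass cap
`m²₊`; threshold `e₁ = 1`, U = 1). [cite: Balaban1983RegularityDecay, Prop. 2.3 of [1] (1.15)–(1.20) p.574 with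
p.572 (torus); dictionary] [folklore] -/
theorem prop23Printed_torusFam (d L : ℕ) (hd : 1 ≤ d) (hL : Odd L ∧ 1 < L) {a : ℝ} (ha : 0 < a) (m2plus : ℝ) :
    B4.Prop23Printed (torusFam d L a m2plus) :=
  B1.prop23Printed_of_literal _ (prop23Literal_torusFam d L hd hL ha m2plus)

/-- The same in B1's intended reading (`B1.Prop23Intended ↔ B4.Prop23Printed`, `Iff.rfl`). [folklore] -/
theorem prop23Intended_torusFam (d L : ℕ) (hd : 1 ≤ d) (hL : Odd L ∧ 1 < L) {a : ℝ} (ha : 0 < a) (m2plus : ℝ) :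
    B1.Prop23Intended (torusFam d L a m2plus) :=
  (B1.prop23Intended_iff_prop23Printed _).2 (prop23Printed_torusFam d L hd hL ha m2plus)

/-- **NON-VACUITY OF THE TYPED COROLLARY, AS A KERNEL STATEMENT (v1.1)**: with the charge a coordinate of the index,
b04's typed «Proposition 2.3 of [1]» (threshold `∃ e₁ > 0`, antecedents `0 < e ≤ e₁`) on the torus family is
EQUIVALENT to B1's literal, threshold-free Prop. 2.3 — for EVERY `d, L, a, m²₊` (no hypotheses): given `e₁`, each
configuration `(P, m², j, Λ)` is met again with charge `e = e₁`, and no carrier field other than `e` changes.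
(Under v1's constant `e := 1` the left side was inhabited by the junk threshold `e₁ := 1/2`; self-audit C-pv07-43.)
[folklore] -/
theorem prop23Printed_torusFam_iff_literal (d L : ℕ) (a m2plus : ℝ) :
    B4.Prop23Printed (torusFam d L a m2plus) ↔ B1.Prop23Literal (torusFam d L a m2plus) := by
  refine ⟨fun ⟨δ₀, c₀, γ₀, γ₁, e₁, hδ, hc, hγ₀, hγ₁, he, h⟩ => ⟨δ₀, c₀, γ₀, γ₁, hδ, hc, hγ₀, hγ₁, fun ι _ _ => ?_⟩,
    B1.prop23Printed_of_literal _⟩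
  exact h { ι with e := e₁ } trivial trivial he le_rfl

/-- hence the typed threshold is met inside EVERY `e₁ > 0` by an instance over any given configuration (here the
configuration of the v1 example below, with charge `e₁`). [folklore] -/
example (e₁ : ℝ) (he : 0 < e₁) :
    ∃ ι : TorusInst 4 3 1, 0 < (torusFam 4 3 1 1 ι).e ∧ (torusFam 4 3 1 1 ι).e ≤ e₁ :=
  ⟨⟨mkP 3 3 1 0 ⟨⟨1, by norm_num⟩, by norm_num⟩, rfl, rfl, 0, le_rfl, 1, le_rfl, le_rfl, by simp, Finset.univ, e₁⟩, he, le_rfl⟩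

/-- non-vacuity: the index type is inhabited (d = 4, L = 3, one RG step m = 1, K = 0, m² = 0, level j = 1,
Λ = T^{(1)}, charge e = 1). -/
example : TorusInst 4 3 1 :=
  ⟨mkP 3 3 1 0 ⟨⟨1, by norm_num⟩, by norm_num⟩, rfl, rfl, 0, le_rfl, 1, le_rfl, le_rfl, by simp, Finset.univ, 1⟩

/-- non-vacuity: Proposition 2.3 of [1] for the four-dimensional torus family with L = 3, a = 1, cap m²₊ = 1. -/
example : B4.Prop23Printed (torusFam 4 3 1 1) :=
  prop23Printed_torusFam 4 3 (by norm_num) ⟨⟨1, by norm_num⟩, by norm_num⟩ one_pos 1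

end Leaf

end

end B4Ineq118Torus

end Literature.MathematicalPhysics.QuantumFieldTheory.Balaban1983to89
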